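import Literature.AlgebraicGeometry.Frobenioids.Thm42SubAssemblyIGeneral
import HarnessLib

/-!
# Frobenioids I, Theorem 4.2 (ii), (iii) AS TYPED over bases of FSM-type — the remaining hypotheses of
# the typed closers discharged by Theorem 4.2 (i)

Mochizuki, *The geometry of Frobenioids I: the general theory*, Kyushu J. Math. **62** (2008)
293–400, Thm. 4.2 (ii)(iii), kurims text pp. 77–78, proof pp. 80–81 [cite: MochizukiFrdI2008, Thm. 4.2 (ii) p.77].

PROOF-ONLY file (seat abc-iut-w4-d090, Thm. 4.2 closeout, L1-lead R81 (4)). Seat abc-iut-L1-t14's typed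
closers `PreFrobenioidData.thm42ii_of_perfectType_of_isOfFSMType` / `thm42iii_of_isOfFSMType`
(`DivisorMonoidCategoryTheoreticityThm42FSM.lean`) carry as hypotheses "`Ψ`, `Ψ⁻¹` preserve primary
pre-steps" [Thm. 4.2 (i)] resp. "`Ψ` preserves Frobenius type, degrees [Thm. 3.4 (iii)] and Div-identity
endomorphisms [Thm. 4.2 (i)]". Those are now theorems of the cell (rows L07 / L11 of the Thm. 4.2 sub-DAG
and seat abc-iut-L1-t13's Thm. 3.4 (iii)), so:

* `FrdI.T42.thm42ii_ofFunctor_of_perfectType_of_isOfFSMType` — **Thm. 4.2 (ii) as typed**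
  (`PreFrobenioidData.Thm42ii`) for Frobenioids of PERFECT type with `Φ_i` perf-factorial over bases of
  FSM-type, with no further hypothesis;
* `FrdI.T42.thm42iii_ofFunctor_of_perfectType_of_isOfFSMType` — **Thm. 4.2 (iii) as typed**
  (`PreFrobenioidData.Thm42iii … e`) in the same setting, for every family `e` of prime bijections
  satisfying the clauses of (ii);
* `FrdI.T42.thm42iii_ofFunctor_of_isOfFSMType_of_perfection` — the same for ARBITRARY Frobenioids, modulo
  the cell's standing named hypothesis `hPf_i : IsFrobenioid (Perfection.ops hF_i).toFunctor` ("`C^pf` is a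
  Frobenioid", cone node Prop. 3.2 (iii)), through `thm42i_of_isOfFSMType_of_perfection`.

The general (non-perfect) case of (ii) needs the transport of the prime bijections along `C → C^pf`
(`Primes(Φ(A)) ≃ Primes(Φ(A)^pf)`, `PerfectionPrimes.lean`) and is not done here. No new definitions.
-/

namespace Literature.AlgebraicGeometry.Frobenioids

namespace FrdI.T42

open CategoryTheory Opposite PreFrobenioidData PreFrobenioid.Perfection

universe w v v' u u'

variable {D₁ : Type u} [Category.{v} D₁] {Φ₁ : D₁ᵒᵖ ⥤ CommMonCat.{w}} {C₁ : Type u'} [Category.{v'} C₁]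
  {D₂ : Type u} [Category.{v} D₂] {Φ₂ : D₂ᵒᵖ ⥤ CommMonCat.{w}} {C₂ : Type u'} [Category.{v'} C₂]
  {F₁ : C₁ ⥤ ElemFrobenioid Φ₁} {F₂ : C₂ ⥤ ElemFrobenioid Φ₂} (Ψ : C₁ ≌ C₂)

/-- The data extracted from `Thm42Setting`: isotropic type (functor form), non-dilating divisor monoids,
and a non-group-like object on each side. [cite: MochizukiFrdI2008, Thm. 4.2 p.77] -/
theorem of_thm42Setting (hT : Thm42Setting (ofFunctor Φ₁ F₁) (ofFunctor Φ₂ F₂)) :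
    PreFrobenioid.IsOfIsotropicType F₁ ∧ PreFrobenioid.IsOfIsotropicType F₂ ∧
      IsNonDilatingOn Φ₁ ∧ IsNonDilatingOn Φ₂ ∧
      (∃ A : C₁, ¬ PreFrobenioid.IsGroupLikeObj F₁ A) ∧ ∃ A : C₂, ¬ PreFrobenioid.IsGroupLikeObj F₂ A := by
  refine ⟨(ofFunctor_isOfIsotropicType F₁).1 hT.isotropic.1, (ofFunctor_isOfIsotropicType F₂).1 hT.isotropic.2,
    isNonDilatingOn_of_ofFunctor hT.standard.1.nonDilating, isNonDilatingOn_of_ofFunctor hT.standard.2.nonDilating,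
    ?_, ?_⟩
  · by_contra h
    exact hT.notGroupLike.1 ⟨fun A => (ofFunctor_isGroupLikeObj F₁ A).2 (not_exists_not.mp h A)⟩
  · by_contra h
    exact hT.notGroupLike.2 ⟨fun A => (ofFunctor_isGroupLikeObj F₂ A).2 (not_exists_not.mp h A)⟩

/-! ### Theorem 4.2 (ii), perfect case -/

/-- **Theorem 4.2 (ii) AS TYPED (`PreFrobenioidData.Thm42ii`), for Frobenioids of perfect type with `Φ_i`
perf-factorial over bases of FSM-type** — seat abc-iut-L1-t14's `thm42ii_of_perfectType_of_isOfFSMType` with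
its hypotheses "`Ψ`, `Ψ⁻¹` preserve primary pre-steps" DISCHARGED by row L07 (`Setting.isPrimaryPreStep_map`,
`Setting.isPrimaryPreStep_inverse_map`, seat abc-iut-w4-d099) over the setting built from `Thm42Setting`
(`setting_of_perfectType_of_isOfFSMType`). [cite: MochizukiFrdI2008, Thm. 4.2 (ii) p.77] -/
theorem thm42ii_ofFunctor_of_perfectType_of_isOfFSMType (hF₁ : PreFrobenioid.IsFrobenioid F₁)
    (hF₂ : PreFrobenioid.IsFrobenioid F₂) (hperf₁ : PreFrobenioid.IsOfPerfectType F₁)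
    (hperf₂ : PreFrobenioid.IsOfPerfectType F₂) (hpf₁ : Objectwise (fun M _ => IsPerfFactorial M) Φ₁)
    (hpf₂ : Objectwise (fun M _ => IsPerfFactorial M) Φ₂) (hD₁ : IsOfFSMType D₁) (hD₂ : IsOfFSMType D₂) :
    (ofFunctor Φ₁ F₁).Thm42ii (ofFunctor Φ₂ F₂) Ψ := by
  intro hT
  obtain ⟨hi₁, hi₂, hnd₁, hnd₂, hN₁, hN₂⟩ := of_thm42Setting hT
  have S : Setting F₁ F₂ Ψ := setting_of_perfectType_of_isOfFSMType Ψ hF₁ hF₂ hperf₁ hperf₂ hi₁ hi₂ hpf₁ hpf₂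
    hT.standard.1.quasiIsotropic hT.standard.2.quasiIsotropic hnd₁ hnd₂ hD₁ hD₂ hN₁ hN₂
  exact thm42ii_of_perfectType_of_isOfFSMType Ψ hF₁ hF₂ hperf₁ hperf₂ hpf₁ hpf₂ hD₁ hD₂
    (fun _ _ _ h => S.isPrimaryPreStep_map h) (fun _ _ _ h => S.isPrimaryPreStep_inverse_map h) hT

/-! ### Theorem 4.2 (iii) -/

/-- **Theorem 4.2 (iii) AS TYPED (`PreFrobenioidData.Thm42iii … e`), for Frobenioids of perfect type with
`Φ_i` perf-factorial over bases of FSM-type**, for every family `e` of prime bijections satisfying the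
clauses of (ii) — seat abc-iut-L1-t14's `thm42iii_of_isOfFSMType` with "`Ψ` preserves Frobenius type,
degrees" DISCHARGED by Thm. 3.4 (iii) (seat abc-iut-L1-t13) and "`Ψ` preserves Div-identity endomorphisms"
by Thm. 4.2 (i) (`thm42i_of_perfectType_of_isOfFSMType`). [cite: MochizukiFrdI2008, Thm. 4.2 (iii) p.78] -/
theorem thm42iii_ofFunctor_of_perfectType_of_isOfFSMType (hF₁ : PreFrobenioid.IsFrobenioid F₁)
    (hF₂ : PreFrobenioid.IsFrobenioid F₂) (hperf₁ : PreFrobenioid.IsOfPerfectType F₁)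
    (hperf₂ : PreFrobenioid.IsOfPerfectType F₂) (hpf₁ : Objectwise (fun M _ => IsPerfFactorial M) Φ₁)
    (hpf₂ : Objectwise (fun M _ => IsPerfFactorial M) Φ₂) (hD₁ : IsOfFSMType D₁) (hD₂ : IsOfFSMType D₂)
    (e : ∀ A : C₁, Primes (Φ₁.obj (op (PreFrobenioid.baseObj F₁ A))) ≃
      Primes (Φ₂.obj (op (PreFrobenioid.baseObj F₂ (Ψ.functor.obj A)))))
    (he : ∀ (A : C₁) (𝔭 : Primes (Φ₁.obj (op (PreFrobenioid.baseObj F₁ A)))),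
      (∀ ⦃B : C₁⦄ (φ : A ⟶ B), PreFrobenioid.IsCoAngularPreStep F₁ φ →
          (PreFrobenioid.Div F₁ φ ∈ 𝔭.submonoid ↔
            PreFrobenioid.Div F₂ (Ψ.functor.map φ) ∈ (e A 𝔭).submonoid)) ∧
        ∀ ⦃B : C₁⦄ (ψ : B ⟶ A), PreFrobenioid.IsCoAngularPreStep F₁ ψ →
          ((∃ y ∈ 𝔭.submonoid, Frobenioids.pull Φ₁ (PreFrobenioid.Base F₁ ψ) y = PreFrobenioid.Div F₁ ψ) ↔
            ∃ y ∈ (e A 𝔭).submonoid, Frobenioids.pull Φ₂ (PreFrobenioid.Base F₂ (Ψ.functor.map ψ)) y =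
              PreFrobenioid.Div F₂ (Ψ.functor.map ψ))) :
    (ofFunctor Φ₁ F₁).Thm42iii (ofFunctor Φ₂ F₂) Ψ e := by
  intro hT
  obtain ⟨-, -, hnd₁, hnd₂, ⟨N₁, hN₁⟩, ⟨N₂, hN₂⟩⟩ := of_thm42Setting hT
  obtain ⟨-, hdiv, -, -⟩ := thm42i_of_perfectType_of_isOfFSMType Ψ hF₁ hF₂ hperf₁ hperf₂ hpf₁ hpf₂ hD₁ hD₂ hT
  exact thm42iii_of_isOfFSMType Ψ hF₁ hF₂ hpf₁ hpf₂ hD₁ hD₂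
    (fun _ _ _ h => FrdI.isFrobeniusType_map_quasiIsotropic hF₁ hF₂ hT.standard.1.quasiIsotropic
      hT.standard.2.quasiIsotropic hD₁ hD₂ hnd₁ hnd₂ Ψ hN₁ hN₂ h)
    (fun _ _ φ => FrdI.degFr_map hF₁ hF₂ hT.standard.1.quasiIsotropic hT.standard.2.quasiIsotropic hD₁ hD₂
      hnd₁ hnd₂ Ψ hN₁ hN₂ φ)
    (fun A α hα => (ofFunctor_isDivIdentity F₂ _).1 (hdiv A α ((ofFunctor_isDivIdentity F₁ α).2 hα))) e he hT

/-- **Theorem 4.2 (iii) AS TYPED for ARBITRARY Frobenioids with `Φ_i` perf-factorial over bases of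
FSM-type, GIVEN that the perfections `C_i^pf` are Frobenioids** (`hPf_i`, cone node Prop. 3.2 (iii)), for
every family `e` satisfying the clauses of (ii): the Div-identity hypothesis is Thm. 4.2 (i) through the
perfections (`thm42i_of_isOfFSMType_of_perfection`). [cite: MochizukiFrdI2008, Thm. 4.2 (iii) p.78] -/
theorem thm42iii_ofFunctor_of_isOfFSMType_of_perfection (hF₁ : PreFrobenioid.IsFrobenioid F₁)
    (hF₂ : PreFrobenioid.IsFrobenioid F₂) (hPf₁ : PreFrobenioid.IsFrobenioid (ops hF₁).toFunctor)
    (hPf₂ : PreFrobenioid.IsFrobenioid (ops hF₂).toFunctor)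
    (hpf₁ : Objectwise (fun M _ => IsPerfFactorial M) Φ₁) (hpf₂ : Objectwise (fun M _ => IsPerfFactorial M) Φ₂)
    (hD₁ : IsOfFSMType D₁) (hD₂ : IsOfFSMType D₂)
    (e : ∀ A : C₁, Primes (Φ₁.obj (op (PreFrobenioid.baseObj F₁ A))) ≃
      Primes (Φ₂.obj (op (PreFrobenioid.baseObj F₂ (Ψ.functor.obj A)))))
    (he : ∀ (A : C₁) (𝔭 : Primes (Φ₁.obj (op (PreFrobenioid.baseObj F₁ A)))),
      (∀ ⦃B : C₁⦄ (φ : A ⟶ B), PreFrobenioid.IsCoAngularPreStep F₁ φ →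
          (PreFrobenioid.Div F₁ φ ∈ 𝔭.submonoid ↔
            PreFrobenioid.Div F₂ (Ψ.functor.map φ) ∈ (e A 𝔭).submonoid)) ∧
        ∀ ⦃B : C₁⦄ (ψ : B ⟶ A), PreFrobenioid.IsCoAngularPreStep F₁ ψ →
          ((∃ y ∈ 𝔭.submonoid, Frobenioids.pull Φ₁ (PreFrobenioid.Base F₁ ψ) y = PreFrobenioid.Div F₁ ψ) ↔
            ∃ y ∈ (e A 𝔭).submonoid, Frobenioids.pull Φ₂ (PreFrobenioid.Base F₂ (Ψ.functor.map ψ)) y =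
              PreFrobenioid.Div F₂ (Ψ.functor.map ψ))) :
    (ofFunctor Φ₁ F₁).Thm42iii (ofFunctor Φ₂ F₂) Ψ e := by
  intro hT
  obtain ⟨-, -, hnd₁, hnd₂, ⟨N₁, hN₁⟩, ⟨N₂, hN₂⟩⟩ := of_thm42Setting hT
  obtain ⟨-, hdiv, -, -⟩ := thm42i_of_isOfFSMType_of_perfection Ψ hF₁ hF₂ hPf₁ hPf₂ hpf₁ hpf₂ hD₁ hD₂ hT
  exact thm42iii_of_isOfFSMType Ψ hF₁ hF₂ hpf₁ hpf₂ hD₁ hD₂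
    (fun _ _ _ h => FrdI.isFrobeniusType_map_quasiIsotropic hF₁ hF₂ hT.standard.1.quasiIsotropic
      hT.standard.2.quasiIsotropic hD₁ hD₂ hnd₁ hnd₂ Ψ hN₁ hN₂ h)
    (fun _ _ φ => FrdI.degFr_map hF₁ hF₂ hT.standard.1.quasiIsotropic hT.standard.2.quasiIsotropic hD₁ hD₂
      hnd₁ hnd₂ Ψ hN₁ hN₂ φ)
    (fun A α hα => (ofFunctor_isDivIdentity F₂ _).1 (hdiv A α ((ofFunctor_isDivIdentity F₁ α).2 hα))) e he hT

end FrdI.T42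

end Literature.AlgebraicGeometry.Frobenioids
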